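import Summits.Ventures.PercRepro.S1CFGDepFourSplit
import Summits.Ventures.PercRepro.S1CFGDepFourArith
import Summits.Ventures.PercRepro.S1CFGTrianglesAll

/-!
# PercRepro — THE DEPENDENT-`4`-SET CAP (p1, gen 40)

`M` finite, simple (no dependent pair), coloop-free, of nullity `ν` on `n` points;
`D₄ := #{X ⊆ E : |X| = 4, rk X ≤ 3}` (the dependent `4`-sets). With
`B(ν, n) := C(ν + 1, 4) + (n − ν − 1)·C(ν + 1, 3) + C(ν + 1, 2)` — the count of the `(ν + 1)`-point line plus a
circuit, plus the `C(ν + 1, 2)` of the rank-`3` case — THE CAP (`ncard_four_eRk_le_three_le_cap`):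
`D₄ ≤ B(ν, n) + (n − 3)` for every `ν ≥ 2` and every `n`.

THE PROOF (induction on `ν` from `2`; the same dichotomy as the triangle cap, S1CFGTrianglesAll):
* `n ≤ ν + 3` (rank `≤ 3`): `D₄ ≤ C(n, 4) ≤ B(ν, n)` (`depFour_small`);
* base `ν = 2`: `D₄ ≤ (n − 3)·c₃ + c₄` (S1CFGFourCircuits) with `c₃ ≤ 2` (S1CFGTrianglesTwo) and the `4`-circuit averaging
  cap `c₄ ≤ ⌊n/(n − 4)⌋`; `2(n − 3) + ⌊n/(n − 4)⌋ ≤ 2n − 3 = B(2, n) + (n − 3)` for `n ≥ 6` (`depFour_base_large`);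
* step `ν = w + 1 ≥ 3`, `n ≥ ν + 4`, NO SERIES PAIR: every `M ↾ (E ∖ {e})` is simple, coloop-free, of nullity `w`
  (restriction package, S1CFGDepFourBase), so by induction `D₄(E ∖ e) ≤ B(w, n − 1) + (n − 4)`; the averaging double
  count gives `(n − 4)·D₄ ≤ n·(B(w, n − 1) + (n − 4)) ≤ (n − 4)·(B(w + 1, n) + (n − 3))` (`depFour_caseB`);
* step, A SERIES PAIR `e, f`: with `Z = Z(e)` the series class (S1CFGSeriesClass: circuits meeting `Z` contain it,
  `E ∖ Z` is simple, coloop-free, of nullity `w`), the split (S1CFGDepFourSplit)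
  `D₄ ≤ D₄(E ∖ Z) + |Z|·c₃(E ∖ Z) + #{dependent 4-sets ⊇ Z}`; the induction hypothesis on `E ∖ Z`, the triangle cap
  `c₃(E ∖ Z) ≤ C(w + 1, 3) + 1` (S1CFGTrianglesAll / S1CFGTrianglesTwo when `|E ∖ Z| ≥ w + 3`; the crude
  `C(w + 2, 3)` when `E ∖ Z` has exactly `w + 2` points), and the count of the sets containing `Z` by `|Z|`
  (`|Z| ≥ 5`: none; `4`: `≤ 1`; `3`: `≤ n − 3`; `2`: `≤ (n − 3) + #𝒬`, `2·#𝒬 ≤ (n − 2)·w`) close by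
  `depFour_caseA` / `depFour_caseA_crude` (the `C(w + 1, 3)`-terms cancel exactly).

Numerals: `D₄ ≤ 138 / 159 / 180` at `ν = 5` on `n = 11 / 12 / 13` and `240 / 276 / 312` at `ν = 6` on `n = 12 / 13 / 14`
(the simple residuals of the rows `p = 11, 12` at `q = 5`; the landed chain had `223 / 241 / 260` and `429 / 461 / 494`).
Nothing about any cell is claimed. Axioms: standard.
-/

open scoped Matroid

namespace PercRepro

namespace S1CFG

open Set S1CF

variable {α : Type}

/-- A set of `≥ 2` points of a matroid with no dependent pair has rank `≥ 2`. -/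
theorem two_le_eRk_toNat_of_no_dep_pair (M : Matroid α) [M.Finite]
    (h0 : {P : Set α | P ⊆ M.E ∧ P.ncard = 2 ∧ M.Dep P}.ncard = 0) {S : Set α} (hS : S ⊆ M.E)
    (hS2 : 2 ≤ S.ncard) : 2 ≤ (M.eRk S).toNat := by
  have hSfin : S.Finite := M.ground_finite.subset hS
  obtain ⟨P, hPS, hP2⟩ := Set.exists_subset_card_eq hS2
  have hPind := indep_of_ncard_eq_two_of_no_dep_pair M h0 (hPS.trans hS) hP2
  have h1 : M.eRk P = 2 := by
    rw [hPind.eRk_eq_encard, ← (hSfin.subset hPS).cast_ncard_eq, hP2]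
    rfl
  have h2 : M.eRk P ≤ M.eRk S := M.eRk_mono hPS
  rw [h1, ← S1.coe_toNat_eRk M hS] at h2
  exact_mod_cast h2

/-- The triangle cap `c₃ ≤ C(w + 1, 3) + 1` for nullity `w ≥ 2` on `≥ w + 3` points (S1CFGTrianglesTwo at `w = 2`,
S1CFGTrianglesAll for `w ≥ 3`). -/
theorem triangle_cap_of_two_le (N : Matroid α) [N.Finite] {w : ℕ} (hw : 2 ≤ w)
    (hd : N.E.encard = N.eRank + (w : ℕ∞)) (hK : ∀ x, ¬ N.IsColoop x)
    (h0 : {P : Set α | P ⊆ N.E ∧ P.ncard = 2 ∧ N.Dep P}.ncard = 0) (hn : w + 3 ≤ N.E.ncard) :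
    {X : Set α | X ⊆ N.E ∧ X.ncard = 3 ∧ N.eRk X ≤ 2}.ncard ≤ (w + 1).choose 3 + 1 := by
  rcases Nat.lt_or_ge w 3 with hlt | hge
  · have hw2 : w = 2 := by omega
    subst hw2
    exact ncard_three_eRk_le_two_le_choose_succ_add_one' N hd hK h0 (by omega)
  · exact ncard_three_eRk_le_two_le_choose_succ_add_one_of_add_three_le w hge N hd hK h0 hn

/-- **THE BASE `ν = 2`**: `D₄ ≤ B(2, n) + (n − 3) = 2n − 3`. -/
theorem ncard_four_eRk_le_three_le_two (M : Matroid α) [M.Finite]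
    (hd : M.E.encard = M.eRank + ((2 : ℕ) : ℕ∞)) (hK : ∀ e, ¬ M.IsColoop e)
    (h0 : {P : Set α | P ⊆ M.E ∧ P.ncard = 2 ∧ M.Dep P}.ncard = 0) :
    {X : Set α | X ⊆ M.E ∧ X.ncard = 4 ∧ M.eRk X ≤ 3}.ncard ≤
      (2 + 1).choose 4 + (M.E.ncard - 2 - 1) * (2 + 1).choose 3 + (2 + 1).choose 2 + (M.E.ncard - 3) := by
  rcases Nat.lt_or_ge M.E.ncard 6 with hlt | hge
  · exact (ncard_four_eRk_le_three_le_choose M (subset_refl M.E)).trans (depFour_base_small (by omega))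
  · have hD := ncard_four_eRk_le_three_le_add M h0
    have hc3 := ncard_three_eRk_le_two_le_choose_succ_add_one' M hd hK h0 (by omega)
    have hc4 := ncard_fourCircuits_le_div M hK hd (by omega)
    exact depFour_base_large hge hD (by simpa using hc3) hc4

/-- **THE INDUCTION STEP** `ν = w + 1 ≥ 3` from the cap at nullity `w` (for every matroid over `α`). -/
theorem ncard_four_eRk_le_three_le_step (M : Matroid α) [M.Finite] {w : ℕ} (hw : 2 ≤ w)
    (hd : M.E.encard = M.eRank + ((w + 1 : ℕ) : ℕ∞)) (hK : ∀ e, ¬ M.IsColoop e)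
    (h0 : {P : Set α | P ⊆ M.E ∧ P.ncard = 2 ∧ M.Dep P}.ncard = 0)
    (ih : ∀ (N : Matroid α) [N.Finite], N.E.encard = N.eRank + (w : ℕ∞) → (∀ x, ¬ N.IsColoop x) →
      {P : Set α | P ⊆ N.E ∧ P.ncard = 2 ∧ N.Dep P}.ncard = 0 →
      {X : Set α | X ⊆ N.E ∧ X.ncard = 4 ∧ N.eRk X ≤ 3}.ncard ≤
        (w + 1).choose 4 + (N.E.ncard - w - 1) * (w + 1).choose 3 + (w + 1).choose 2 + (N.E.ncard - 3)) :
    {X : Set α | X ⊆ M.E ∧ X.ncard = 4 ∧ M.eRk X ≤ 3}.ncard ≤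
      (w + 2).choose 4 + (M.E.ncard - (w + 1) - 1) * (w + 2).choose 3 + (w + 2).choose 2 + (M.E.ncard - 3) := by
  have hEfin := M.ground_finite
  have hnE := ncard_ground_eq_eRk_toNat_add M hd
  -- the small case `n ≤ ν + 3`
  rcases Nat.lt_or_ge M.E.ncard (w + 5) with hlt | hn
  · have := (ncard_four_eRk_le_three_le_choose M (subset_refl M.E)).trans
      (depFour_small (ν := w + 1) (n := M.E.ncard) (by omega))
    simpa using this
  have hn2 : 2 ≤ M.E.ncard := by omega
  by_cases hser : ∃ e ∈ M.E, ∃ f ∈ M.E, e ≠ f ∧ f ∉ M.closure (M.E \ {e, f})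
  · -- CASE A: a series pair
    obtain ⟨e, he, f, hf, hef, hser⟩ := hser
    set Z := {z | z ∈ M.E ∧ (z = e ∨ z ∉ M.closure (M.E \ {e, z}))} with hZ
    have hZE : Z ⊆ M.E := seriesClass_subset_ground M e
    have hZfin : Z.Finite := hEfin.subset hZE
    have hZcirc : ∀ C, M.IsCircuit C → ∀ z ∈ Z, z ∈ C → Z ⊆ C :=
      fun C hC z hz hzC => isCircuit_seriesClass_subset M hK he hC hz hzC
    have hZ2 : 2 ≤ Z.ncard := two_le_ncard_seriesClass M he hf hef hser
    have hfZ : f ∈ Z := ⟨hf, Or.inr hser⟩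
    have heZ : e ∈ Z := mem_seriesClass_self M he
    -- the complement `S = E ∖ Z`
    set S := M.E \ Z with hS
    have hSE : S ⊆ M.E := sdiff_subset
    have hSfin : S.Finite := hEfin.subset hSE
    haveI : (M ↾ S).Finite := M.restrict_finite hSfin
    have hmz : S.ncard + Z.ncard = M.E.ncard := Set.ncard_sdiff_add_ncard_of_subset hZE hEfin
    have hnull : S.ncard = (M.eRk S).toNat + w := by
      have := ncard_sdiff_seriesClass_eq M hd hK he (by omega)
      rw [Nat.add_sub_cancel] at this
      exact this
    have hd' := restrict_hd M hSE hnull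
    have hK' := restrict_hK M hSE (fun g hg => mem_closure_sdiff_seriesClass M hK he hg)
    have h0' := restrict_h0 M hSE h0
    -- the induction hypothesis on `S`
    have hD' := ih (M ↾ S) hd' hK' h0'
    rw [restrict_count_four, Matroid.restrict_ground_eq] at hD'
    -- `S` has at least `w + 2` points
    have hS2 : w + 2 ≤ S.ncard := by
      rcases Nat.lt_or_ge S.ncard 2 with hlt | hge
      · omega
      · have := two_le_eRk_toNat_of_no_dep_pair M h0 hSE hge
        omega
    -- the split along `Z`
    have hsplit := ncard_four_eRk_le_three_le_sdiff_add_of_circuits M h0 hn2 hZE hZcirc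
    rw [← hS] at hsplit
    -- the count of the dependent `4`-sets containing `Z`, by `|Z|`
    rcases Nat.lt_or_ge S.ncard (w + 3) with hSlt | hSge
    · -- the degenerate case `|S| = w + 2`: the crude triangle cap, `|Z| ≥ 3`
      have hSeq : S.ncard = w + 2 := by omega
      have hz3 : 3 ≤ Z.ncard := by omega
      have hc3 : {T : Set α | T ⊆ S ∧ T.ncard = 3 ∧ M.eRk T ≤ 2}.ncard ≤ (w + 2).choose 3 := by
        have := ncard_three_eRk_le_two_le_of_no_dep_pair_restrict M h0 hSE
        have hval : S.ncard - (M.eRk S).toNat + 2 = w + 2 := by omega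
        rw [hval] at this
        exact this
      have hextra : {X : Set α | X ⊆ M.E ∧ X.ncard = 4 ∧ M.eRk X ≤ 3 ∧ Z ⊆ X}.ncard ≤ M.E.ncard - 1 := by
        rcases Nat.lt_or_ge Z.ncard 5 with hz5 | hz5
        · rcases Nat.lt_or_ge Z.ncard 4 with hz4 | hz4
          · have hz : Z.ncard = 3 := by omega
            exact (ncard_four_eRk_le_three_superset_le_sub_three M hZE hz).trans (by omega)
          · have hz : Z.ncard = 4 := by omega
            exact (ncard_four_eRk_le_three_superset_le_one M hz).trans (by omega)
        · rw [ncard_four_eRk_le_three_superset_eq_zero M hz5]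
          exact Nat.zero_le _
      exact depFour_caseA_crude (by omega) hmz hSeq hz3 hsplit hD' hc3 hextra
    · -- the main case `|S| ≥ w + 3`: the triangle cap at nullity `w`
      have hc3 : {T : Set α | T ⊆ S ∧ T.ncard = 3 ∧ M.eRk T ≤ 2}.ncard ≤ (w + 1).choose 3 + 1 := by
        have := triangle_cap_of_two_le (M ↾ S) hw hd' hK' h0' (by rw [Matroid.restrict_ground_eq]; exact hSge)
        rw [restrict_count_three] at this
        exact this
      have hextra : {X : Set α | X ⊆ M.E ∧ X.ncard = 4 ∧ M.eRk X ≤ 3 ∧ Z ⊆ X}.ncard ≤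
          (M.E.ncard - w - 2) * (w + 1).choose 2 + (w + 1) := by
        rcases Nat.lt_or_ge Z.ncard 5 with hz5 | hz5
        · rcases Nat.lt_or_ge Z.ncard 4 with hz4 | hz4
          · rcases Nat.lt_or_ge Z.ncard 3 with hz3 | hz3
            · -- `|Z| = 2`: `Z = {e, f}`
              have hz : Z.ncard = 2 := by omega
              have hZeq : Z = {e, f} := by
                symm
                apply Set.eq_of_subset_of_ncard_le
                · intro x hx
                  rcases hx with rfl | rfl
                  · exact heZ
                  · exact hfZ
                · rw [hz, ncard_pair hef]
                · exact hZfin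
              rw [hZeq] at hZcirc ⊢
              have h1 := ncard_four_eRk_le_three_superset_pair_le M hK h0 hn2 he hf hef hser hZcirc
              have h2 := two_mul_ncard_fourCircuits_pair_le M hd hK he hf hef (by omega)
              rw [Nat.add_sub_cancel] at h2
              exact h1.trans (extra_two_le hw hn h2)
            · have hz : Z.ncard = 3 := by omega
              exact (ncard_four_eRk_le_three_superset_le_sub_three M hZE hz).trans (extra_three_le hw hn)
          · have hz : Z.ncard = 4 := by omega
            exact (ncard_four_eRk_le_three_superset_le_one M hz).trans (by omega)
        · rw [ncard_four_eRk_le_three_superset_eq_zero M hz5]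
          exact Nat.zero_le _
      exact depFour_caseA hmz hSge hsplit hD' hc3 hextra
  · -- CASE B: no series pair — average over the single deletions
    push Not at hser
    have hB : ∀ e ∈ M.E, {X : Set α | X ⊆ M.E \ {e} ∧ X.ncard = 4 ∧ M.eRk X ≤ 3}.ncard ≤
        (w + 1).choose 4 + (M.E.ncard - 1 - w - 1) * (w + 1).choose 3 + (w + 1).choose 2 + (M.E.ncard - 1 - 3) := by
      intro e he
      have hSE : M.E \ {e} ⊆ M.E := sdiff_subset
      haveI : (M ↾ (M.E \ {e})).Finite := M.restrict_finite (hEfin.subset hSE)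
      have hnull : (M.E \ {e}).ncard = (M.eRk (M.E \ {e})).toNat + w := by
        have := ncard_sdiff_singleton_eq_eRk_toNat_add M hd hK he (by omega)
        rw [Nat.add_sub_cancel] at this
        exact this
      have hd' := restrict_hd M hSE hnull
      have hK' := restrict_hK M hSE (fun x hx => by
        rw [sdiff_singleton_sdiff_singleton_eq]
        exact hser e he x hx.1 (fun h => hx.2 (h ▸ mem_singleton e)))
      have h0' := restrict_h0 M hSE h0
      have := ih (M ↾ (M.E \ {e})) hd' hK' h0'
      rw [restrict_count_four, Matroid.restrict_ground_eq, Set.ncard_sdiff_singleton_of_mem he] at this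
      exact this
    have h1 := mul_ncard_four_eRk_le_three_le M hB
    have h2 := depFour_caseB hw hn
    have h3 := h1.trans h2
    exact Nat.le_of_mul_le_mul_left h3 (by omega)

/-- **THE DEPENDENT-`4`-SET CAP**: for every `ν ≥ 2`, a simple (no dependent pair), coloop-free matroid of nullity `ν`
on `n` points has at most `C(ν + 1, 4) + (n − ν − 1)·C(ν + 1, 3) + C(ν + 1, 2) + (n − 3)` dependent `4`-sets
(`4`-sets of rank `≤ 3`). -/
theorem ncard_four_eRk_le_three_le_of_two_le :
    ∀ ν : ℕ, 2 ≤ ν → ∀ (M : Matroid α) [M.Finite], M.E.encard = M.eRank + (ν : ℕ∞) →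
      (∀ e, ¬ M.IsColoop e) → {P : Set α | P ⊆ M.E ∧ P.ncard = 2 ∧ M.Dep P}.ncard = 0 →
      {X : Set α | X ⊆ M.E ∧ X.ncard = 4 ∧ M.eRk X ≤ 3}.ncard ≤
        (ν + 1).choose 4 + (M.E.ncard - ν - 1) * (ν + 1).choose 3 + (ν + 1).choose 2 + (M.E.ncard - 3) := by
  intro ν hν
  induction ν, hν using Nat.le_induction with
  | base =>
    intro M _ hd hK h0
    exact ncard_four_eRk_le_three_le_two M hd hK h0
  | succ w hw ih =>
    intro M _ hd hK h0
    have := ncard_four_eRk_le_three_le_step M hw hd hK h0 ih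
    simpa using this

/-- The cap in the usual hypothesis form. -/
theorem ncard_four_eRk_le_three_le_cap (M : Matroid α) [M.Finite] {ν : ℕ}
    (hd : M.E.encard = M.eRank + (ν : ℕ∞)) (hK : ∀ e, ¬ M.IsColoop e)
    (h0 : {P : Set α | P ⊆ M.E ∧ P.ncard = 2 ∧ M.Dep P}.ncard = 0) (hν : 2 ≤ ν) :
    {X : Set α | X ⊆ M.E ∧ X.ncard = 4 ∧ M.eRk X ≤ 3}.ncard ≤
      (ν + 1).choose 4 + (M.E.ncard - ν - 1) * (ν + 1).choose 3 + (ν + 1).choose 2 + (M.E.ncard - 3) :=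
  ncard_four_eRk_le_three_le_of_two_le ν hν M hd hK h0

/-- `D₄ ≤ 159` at nullity `5` on `12` points. -/
theorem depFour_le_of_nullity_five_twelve (M : Matroid α) [M.Finite]
    (hd : M.E.encard = M.eRank + 5) (hK : ∀ e, ¬ M.IsColoop e)
    (h0 : {P : Set α | P ⊆ M.E ∧ P.ncard = 2 ∧ M.Dep P}.ncard = 0) (hn : M.E.ncard = 12) :
    {X : Set α | X ⊆ M.E ∧ X.ncard = 4 ∧ M.eRk X ≤ 3}.ncard ≤ 159 := by
  have := ncard_four_eRk_le_three_le_cap M (ν := 5) (by exact_mod_cast hd) hK h0 (by norm_num)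
  rw [hn] at this
  exact this.trans (by decide)

/-- `D₄ ≤ 276` at nullity `6` on `13` points. -/
theorem depFour_le_of_nullity_six_thirteen (M : Matroid α) [M.Finite]
    (hd : M.E.encard = M.eRank + 6) (hK : ∀ e, ¬ M.IsColoop e)
    (h0 : {P : Set α | P ⊆ M.E ∧ P.ncard = 2 ∧ M.Dep P}.ncard = 0) (hn : M.E.ncard = 13) :
    {X : Set α | X ⊆ M.E ∧ X.ncard = 4 ∧ M.eRk X ≤ 3}.ncard ≤ 276 := by
  have := ncard_four_eRk_le_three_le_cap M (ν := 6) (by exact_mod_cast hd) hK h0 (by norm_num)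
  rw [hn] at this
  exact this.trans (by decide)

end S1CFG

end PercRepro
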